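import Mathlib
import Summits.ValiantsHypothesis.ValiantsHypothesis.Theses.ProofCarryingSymmetry
import Summits.ValiantsHypothesis.ValiantsHypothesis.Theorems.MonotoneRestorationMonotoneRestorationQPFoolingOfQPSymmetric
import Summits.ValiantsHypothesis.ValiantsHypothesis.Theorems.ProofCarryingSymmetryRestorationQPArithmeticCFIDichotomy
import Summits.ValiantsHypothesis.ValiantsHypothesis.Theorems.ProofCarryingSymmetryStabilityIff

/-!
# Route ProofCarryingSymmetry — crux `RestorationQP` and its bet at POLYLOGARITHMIC counting width

Support file for the crux item `stmt-ValiantsHypothesis-10343` (lead c4, cycle 4).  Cycle 3 made the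
crux's kill criterion formal at LINEAR scale (`ArithmeticCFI`: an invariant VP family separating
`≡^{C^{εn}}`-equivalent graphs infinitely often; engine = Dawar–Wilsenach Thm 5.1 + the coarse Thm 6.4).
The sibling route MonotoneRestoration has since landed the per-order POLYLOG engine
`stub_fooling_of_qpSymmetric` (Thm 5.1 + reduced rigidification with the Support Theorem +
Anderson–Dawar: a polynomial with an `S_n`-symmetric circuit of `≤ 2^{(log₂ n + c)^c}` gates takes
equal values at the adjacency matrices of `≡^{C^{(log₂ n + c')^{c'}}}`-equivalent graphs, `c' = c + 10`,
EVERY `n`).  Read through it, the crux and the bet of line `registered` say, and die from, the following.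

* `widthLawVP_of_restorationQP` — **crux ⇒ WIDTH LAW**: every diagonally `S_n`-invariant VP family
  over `ℂ` has, for some `c'` and EVERY `n`, equal values at `≡^{C^{(log₂ n + c')^{c'}}}`-equivalent
  `n`-vertex graphs (polylogarithmic counting width of its Boolean shadow, uniformly in `n`).
* `RestorationQP_false_of_polylogWidthVP` — **the kill instrument at the right scale**: ONE
  diagonally invariant VP family which, for every `c'`, separates SOME pair of
  `≡^{C^{(log₂ n + c')^{c'}}}`-equivalent graphs at SOME order `n`, refutes the crux (no `εn`, no
  "infinitely often": cycle 3's `ArithmeticCFI` is the special case `polylogWidthVP_of_arithmeticCFI`).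
* `valiantsHypothesis_of_widthLawVP` — **the width law alone decides the summit** (through
  `arithmeticCFI_or_valiantsHypothesis`: were `per ∈ VP`, the permanent would break the law on
  Dawar–Wilsenach's CFI pairs); so `RestorationQP ⇒ WidthLawVP ⇒ VH`: the width law is a strictly
  thinner sufficient crux for this route than restoration (planner hint), and
  `polylogWidthVP_or_valiantsHypothesis` is the dichotomy at polylog scale.
* (Remark, not formalised here to keep the routes' audit graphs apart: the sibling route's filed
  kill witness `MonotoneRestoration.PolylogWidthMonotoneEasy`, item stmt-17619, kills THIS crux as
  well — `widthKillsRestoration_proof ∘ monotoneRestorationQP_of_diagonalRestorationQP`; one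
  construction item serves both routes.)
* `proofCarryingWidthLaw_of_stabilityOfProvableSymmetry`, `stabilityOfProvableSymmetry_false_of_polylogProofCarrying`,
  `proofsToDistEquiv_false_of_polylogProofCarrying` — the same for the BET (L, item stmt-10358, ≡ the
  registered stub S2⁗): L ⇒ circuits of quasi-polynomial size WITH quasi-polynomial invariance proofs
  have polylog counting width; a quasi-polynomial proof-carrying family separating at every polylog
  level at some order refutes L and S2⁗ (cycle 3's `…_false_of_subexpSeparating` needed `2^{o(n)}` size
  against LINEAR width infinitely often).

Pure composition of tree theorems and `Nat.log` arithmetic; no definitions, no named facts.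
-/

-- single-problem summit: `Summit.ValiantsHypothesis.ValiantsHypothesis.…` is the namespace by design (D-0017)
set_option linter.dupNamespace false

noncomputable section

open scoped Classical

namespace Summit.ValiantsHypothesis.ValiantsHypothesis.Theorems

open Filter
open Literature.Computability.AlgebraicComplexity
open Literature.ModelTheory.FiniteModelTheory
open Summit.ValiantsHypothesis.ValiantsHypothesis.Theses.ProofCarryingSymmetry (RestorationQP)

/-! ### The crux at polylog scale -/

/-- **Crux ⇒ width law.** If `RestorationQP` holds, every diagonally `S_n`-invariant VP family `f`
over `ℂ` has polylogarithmic counting width uniformly in `n`: for some `c'` and every `n`, `f_n` takes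
the same value at the `0/1` adjacency matrices of any two `≡^{C^{(log₂ n + c')^{c'}}}`-equivalent graphs
on `Fin n` (the crux's symmetric circuits of size `2^{(log₂ n + c)^c}` fed to the per-order engine
`stub_fooling_of_qpSymmetric`, `c' = c + 10`). [cite: DawarWilsenach2025, §6 p. 17 and Thm. 5.1] -/
theorem widthLawVP_of_restorationQP (hR : RestorationQP) :
    ∀ f : (n : ℕ) → MvPolynomial (Fin n × Fin n) ℂ,
      (∀ (n : ℕ) (σ : Equiv.Perm (Fin n)),
        MvPolynomial.rename (fun x : Fin n × Fin n => σ • x) (f n) = f n) →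
      IsVPFamily f →
      ∃ c' : ℕ, ∀ (n : ℕ) (X Y : SimpleGraph (Fin n)),
        CkEquiv ((Nat.log 2 n + c') ^ c') X Y →
        MvPolynomial.eval (Set.indicator {ij : Fin n × Fin n | X.Adj ij.1 ij.2} 1) (f n) =
          MvPolynomial.eval (Set.indicator {ij : Fin n × Fin n | Y.Adj ij.1 ij.2} 1) (f n) := by
  intro f hsymm hVP
  obtain ⟨c, hc⟩ := hR f hsymm hVP
  obtain ⟨c', hc'⟩ := stub_fooling_of_qpSymmetric c
  exact ⟨c', fun n X Y hXY => hc' n (f n) (hc n) X Y hXY⟩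

/-- **The kill instrument at polylog scale.** A diagonally `S_n`-invariant VP family over `ℂ` which,
for every `c'`, separates at SOME order `n` SOME pair of `≡^{C^{(log₂ n + c')^{c'}}}`-equivalent graphs
(by its values at their adjacency matrices) refutes `RestorationQP`. [folklore] -/
theorem RestorationQP_false_of_polylogWidthVP
    (h : ∃ f : (n : ℕ) → MvPolynomial (Fin n × Fin n) ℂ,
      (∀ (n : ℕ) (σ : Equiv.Perm (Fin n)),
        MvPolynomial.rename (fun x : Fin n × Fin n => σ • x) (f n) = f n) ∧
      IsVPFamily f ∧
      ∀ c' : ℕ, ∃ (n : ℕ) (X Y : SimpleGraph (Fin n)),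
        CkEquiv ((Nat.log 2 n + c') ^ c') X Y ∧
        MvPolynomial.eval (Set.indicator {ij : Fin n × Fin n | X.Adj ij.1 ij.2} 1) (f n) ≠
          MvPolynomial.eval (Set.indicator {ij : Fin n × Fin n | Y.Adj ij.1 ij.2} 1) (f n)) :
    ¬ RestorationQP := by
  rintro hR
  obtain ⟨f, hsymm, hVP, hsep⟩ := h
  obtain ⟨c', hc'⟩ := widthLawVP_of_restorationQP hR f hsymm hVP
  obtain ⟨n, X, Y, hXY, hne⟩ := hsep c'
  exact hne (hc' n X Y hXY)

/-- The `0/1` input of the statement (`if X.Adj i j then 1 else 0`) is the indicator used by the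
engine. [folklore] -/
theorem ite_adj_eq_indicator {n : ℕ} (X : SimpleGraph (Fin n)) :
    (fun ij : Fin n × Fin n => if X.Adj ij.1 ij.2 then (1 : ℂ) else 0) =
      Set.indicator {ij : Fin n × Fin n | X.Adj ij.1 ij.2} 1 := by
  funext ij
  by_cases h : X.Adj ij.1 ij.2 <;> simp [h]

/-- **Width law ⇒ no arithmetic CFI family** (linear width `εn` exceeds every polylog level
eventually, `natLog_add_pow_lt_mul_eventually`). [folklore] -/
theorem not_arithmeticCFI_of_widthLawVP
    (hW : ∀ f : (n : ℕ) → MvPolynomial (Fin n × Fin n) ℂ,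
      (∀ (n : ℕ) (σ : Equiv.Perm (Fin n)),
        MvPolynomial.rename (fun x : Fin n × Fin n => σ • x) (f n) = f n) →
      IsVPFamily f →
      ∃ c' : ℕ, ∀ (n : ℕ) (X Y : SimpleGraph (Fin n)),
        CkEquiv ((Nat.log 2 n + c') ^ c') X Y →
        MvPolynomial.eval (Set.indicator {ij : Fin n × Fin n | X.Adj ij.1 ij.2} 1) (f n) =
          MvPolynomial.eval (Set.indicator {ij : Fin n × Fin n | Y.Adj ij.1 ij.2} 1) (f n)) :
    ¬ ArithmeticCFI := by
  rintro ⟨f, hsymm, hVP, ε, hε, hfreq⟩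
  obtain ⟨c', hc'⟩ := hW f hsymm hVP
  obtain ⟨n₀, hn₀⟩ := Summit.ValiantsHypothesis.Theorems.ProofCarryingSymmetry.natLog_add_pow_lt_mul_eventually c' hε
  obtain ⟨n, ⟨k, hk, X, Y, hXY, hne⟩, hn⟩ := (hfreq.and_eventually (eventually_ge_atTop n₀)).exists
  have hlevel : (Nat.log 2 n + c') ^ c' ≤ k := by
    have h1 : (((Nat.log 2 n + c') ^ c' : ℕ) : ℝ) < ε * n := hn₀ n hn
    exact_mod_cast (h1.le.trans hk)
  apply hne
  rw [ite_adj_eq_indicator X, ite_adj_eq_indicator Y]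
  exact hc' n X Y (hXY.mono hlevel)

/-- **The width law alone decides the summit**: if every diagonally invariant VP family over `ℂ` has
polylogarithmic counting width (uniformly in `n`), then `VP_ℂ ≠ VNP_ℂ` — through the unconditional
dichotomy `arithmeticCFI_or_valiantsHypothesis` (were `per ∈ VP`, the permanent family would be an
arithmetic CFI family, Dawar–Wilsenach Thm 7.2).  With `widthLawVP_of_restorationQP`:
`RestorationQP ⇒ width law ⇒ VH`, so the width law is a thinner sufficient crux for this route than
restoration. [folklore] -/
theorem valiantsHypothesis_of_widthLawVP
    (hW : ∀ f : (n : ℕ) → MvPolynomial (Fin n × Fin n) ℂ,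
      (∀ (n : ℕ) (σ : Equiv.Perm (Fin n)),
        MvPolynomial.rename (fun x : Fin n × Fin n => σ • x) (f n) = f n) →
      IsVPFamily f →
      ∃ c' : ℕ, ∀ (n : ℕ) (X Y : SimpleGraph (Fin n)),
        CkEquiv ((Nat.log 2 n + c') ^ c') X Y →
        MvPolynomial.eval (Set.indicator {ij : Fin n × Fin n | X.Adj ij.1 ij.2} 1) (f n) =
          MvPolynomial.eval (Set.indicator {ij : Fin n × Fin n | Y.Adj ij.1 ij.2} 1) (f n)) :
    _root_.ValiantsHypothesis :=
  arithmeticCFI_or_valiantsHypothesis.resolve_left (not_arithmeticCFI_of_widthLawVP hW)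

/-- **Dichotomy at polylog scale**: either some diagonally invariant VP family over `ℂ` separates,
for every `c'`, some pair of `≡^{C^{(log₂ n + c')^{c'}}}`-equivalent graphs at some order (which kills
the crux, `RestorationQP_false_of_polylogWidthVP`), or `VP_ℂ ≠ VNP_ℂ`. [folklore] -/
theorem polylogWidthVP_or_valiantsHypothesis : (∃ f : (n : ℕ) → MvPolynomial (Fin n × Fin n) ℂ, (∀ (n : ℕ) (σ : Equiv.Perm (Fin n)), MvPolynomial.rename (fun x : Fin n × Fin n => σ • x) (f n) = f n) ∧ IsVPFamily f ∧ ∀ c' : ℕ, ∃ (n : ℕ) (X Y : SimpleGraph (Fin n)), CkEquiv ((Nat.log 2 n + c') ^ c') X Y ∧ MvPolynomial.eval (Set.indicator {ij : Fin n × Fin n | X.Adj ij.1 ij.2} 1) (f n) ≠ MvPolynomial.eval (Set.indicator {ij : Fin n × Fin n | Y.Adj ij.1 ij.2} 1) (f n)) ∨ _root_.ValiantsHypothesis := by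
  by_cases hW : ∀ f : (n : ℕ) → MvPolynomial (Fin n × Fin n) ℂ,
      (∀ (n : ℕ) (σ : Equiv.Perm (Fin n)),
        MvPolynomial.rename (fun x : Fin n × Fin n => σ • x) (f n) = f n) →
      IsVPFamily f →
      ∃ c' : ℕ, ∀ (n : ℕ) (X Y : SimpleGraph (Fin n)),
        CkEquiv ((Nat.log 2 n + c') ^ c') X Y →
        MvPolynomial.eval (Set.indicator {ij : Fin n × Fin n | X.Adj ij.1 ij.2} 1) (f n) =
          MvPolynomial.eval (Set.indicator {ij : Fin n × Fin n | Y.Adj ij.1 ij.2} 1) (f n)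
  · exact Or.inr (valiantsHypothesis_of_widthLawVP hW)
  · left
    push Not at hW
    obtain ⟨f, hsymm, hVP, hsep⟩ := hW
    exact ⟨f, hsymm, hVP, fun c' => hsep c'⟩

/-- **Cycle 3's linear-scale witness is a polylog-scale witness**: an arithmetic CFI family separates
at every polylog level at some order. [folklore] -/
theorem polylogWidthVP_of_arithmeticCFI (h : ArithmeticCFI) :
    ∃ f : (n : ℕ) → MvPolynomial (Fin n × Fin n) ℂ,
      (∀ (n : ℕ) (σ : Equiv.Perm (Fin n)),
        MvPolynomial.rename (fun x : Fin n × Fin n => σ • x) (f n) = f n) ∧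
      IsVPFamily f ∧
      ∀ c' : ℕ, ∃ (n : ℕ) (X Y : SimpleGraph (Fin n)),
        CkEquiv ((Nat.log 2 n + c') ^ c') X Y ∧
        MvPolynomial.eval (Set.indicator {ij : Fin n × Fin n | X.Adj ij.1 ij.2} 1) (f n) ≠
          MvPolynomial.eval (Set.indicator {ij : Fin n × Fin n | Y.Adj ij.1 ij.2} 1) (f n) := by
  by_contra hcon
  push Not at hcon
  exact not_arithmeticCFI_of_widthLawVP hcon h

/-! ### The bet at polylog scale -/

/-- Exponent bookkeeping: `(2^M)^c ≤ 2^((L + (a + c))^(a + c))` for `M = (L + a)^a`. [folklore] -/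
theorem polylog_pow_absorb (L a c : ℕ) :
    (2 ^ ((L + a) ^ a)) ^ c ≤ 2 ^ ((L + (a + c)) ^ (a + c)) := by
  rw [← pow_mul]
  refine Nat.pow_le_pow_right (by norm_num) ?_
  rcases Nat.eq_zero_or_pos c with rfl | hc
  · simp
  · have h1 : (L + a) ^ a ≤ (L + (a + c)) ^ a := Nat.pow_le_pow_left (by omega) _
    have h2 : c ≤ (L + (a + c)) ^ c :=
      calc c ≤ L + (a + c) := by omega
        _ = (L + (a + c)) ^ 1 := (pow_one _).symm
        _ ≤ (L + (a + c)) ^ c := Nat.pow_le_pow_right (by omega) hc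
    calc (L + a) ^ a * c ≤ (L + (a + c)) ^ a * (L + (a + c)) ^ c := Nat.mul_le_mul h1 h2
      _ = (L + (a + c)) ^ (a + c) := by rw [← pow_add]

/-- **L ⇒ proof-carrying width law.**  If the route's stability statement L holds (all-`σ` form:
size-`t` `P_c(ℂ)` proofs of all invariance identities of `C` ⇒ an `S_n`-symmetric circuit for `Ĉ` of
size `≤ (|C| + t + n + 2)^c`), then for every quasi-polynomial scale `a` there is `c'` such that, at
every order `n`, every circuit `C` with such proofs and `|C| + t + n + 2 ≤ 2^{(log₂ n + a)^a}` computes a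
polynomial with equal values at `≡^{C^{(log₂ n + c')^{c'}}}`-equivalent graphs. [folklore] -/
theorem proofCarryingWidthLaw_of_stabilityOfProvableSymmetry
    (hL : ∃ c : ℕ, ∀ (n t : ℕ) (C : PICircuit ℂ (Fin n × Fin n)),
      (∀ σ : Equiv.Perm (Fin n), HasPCProofOfSize (C.rename fun x : Fin n × Fin n => σ • x) C t) →
      ∃ (G : Type) (_ : Fintype G) (D : LabelledArithCircuit ℂ (Fin n × Fin n) Unit G),
        D.IsSymmetric (Equiv.Perm (Fin n)) ∧ D.eval (D.output ()) = C.eval ∧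
        Fintype.card G ≤ (C.size + t + n + 2) ^ c)
    (a : ℕ) :
    ∃ c' : ℕ, ∀ (n t : ℕ) (C : PICircuit ℂ (Fin n × Fin n)),
      (∀ σ : Equiv.Perm (Fin n), HasPCProofOfSize (C.rename fun x : Fin n × Fin n => σ • x) C t) →
      C.size + t + n + 2 ≤ 2 ^ ((Nat.log 2 n + a) ^ a) →
      ∀ X Y : SimpleGraph (Fin n), CkEquiv ((Nat.log 2 n + c') ^ c') X Y →
        MvPolynomial.eval (Set.indicator {ij : Fin n × Fin n | X.Adj ij.1 ij.2} 1) C.eval =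
          MvPolynomial.eval (Set.indicator {ij : Fin n × Fin n | Y.Adj ij.1 ij.2} 1) C.eval := by
  obtain ⟨c, hc⟩ := hL
  obtain ⟨c', hc'⟩ := stub_fooling_of_qpSymmetric (a + c)
  refine ⟨c', fun n t C hpf hsmall X Y hXY => hc' n C.eval ?_ X Y hXY⟩
  obtain ⟨G, hG, D, hsym, hev, hcard⟩ := hc n t C hpf
  refine ⟨G, hG, D, hsym, hev, hcard.trans ?_⟩
  exact (Nat.pow_le_pow_left hsmall c).trans (polylog_pow_absorb (Nat.log 2 n) a c)

/-- **A quasi-polynomial proof-carrying family separating at every polylog level refutes L** (item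
stmt-10358, all-`σ` form).  Witness (inline): one scale `a` and, for every level `c'`, some order `n`,
some circuit `C` with size-`t` proofs of all `C ∘ σ = C`, `|C| + t + n + 2 ≤ 2^{(log₂ n + a)^a}`, and two
`≡^{C^{(log₂ n + c')^{c'}}}`-equivalent graphs separated by `Ĉ`. [folklore] -/
theorem stabilityOfProvableSymmetry_false_of_polylogProofCarrying
    (h : ∃ a : ℕ, ∀ c' : ℕ, ∃ (n t : ℕ) (C : PICircuit ℂ (Fin n × Fin n)),
      (∀ σ : Equiv.Perm (Fin n), HasPCProofOfSize (C.rename fun x : Fin n × Fin n => σ • x) C t) ∧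
      C.size + t + n + 2 ≤ 2 ^ ((Nat.log 2 n + a) ^ a) ∧
      ∃ X Y : SimpleGraph (Fin n), CkEquiv ((Nat.log 2 n + c') ^ c') X Y ∧
        MvPolynomial.eval (Set.indicator {ij : Fin n × Fin n | X.Adj ij.1 ij.2} 1) C.eval ≠
          MvPolynomial.eval (Set.indicator {ij : Fin n × Fin n | Y.Adj ij.1 ij.2} 1) C.eval) :
    ¬ ∃ c : ℕ, ∀ (n t : ℕ) (C : PICircuit ℂ (Fin n × Fin n)),
      (∀ σ : Equiv.Perm (Fin n), HasPCProofOfSize (C.rename fun x : Fin n × Fin n => σ • x) C t) →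
      ∃ (G : Type) (_ : Fintype G) (D : LabelledArithCircuit ℂ (Fin n × Fin n) Unit G),
        D.IsSymmetric (Equiv.Perm (Fin n)) ∧ D.eval (D.output ()) = C.eval ∧
        Fintype.card G ≤ (C.size + t + n + 2) ^ c := by
  rintro hL
  obtain ⟨a, hsep⟩ := h
  obtain ⟨c', hc'⟩ := proofCarryingWidthLaw_of_stabilityOfProvableSymmetry hL a
  obtain ⟨n, t, C, hpf, hsmall, X, Y, hXY, hne⟩ := hsep c'
  exact hne (hc' n t C hpf hsmall X Y hXY)

/-- **… and refutes the registered bet S2⁗** (`stub_proofsToDistEquiv` of line `registered`), through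
`stabilityOfProvableSymmetry_iff_proofsToDistEquiv` (L ⟺ S2⁗, p159602). [folklore] -/
theorem proofsToDistEquiv_false_of_polylogProofCarrying
    (h : ∃ a : ℕ, ∀ c' : ℕ, ∃ (n t : ℕ) (C : PICircuit ℂ (Fin n × Fin n)),
      (∀ σ : Equiv.Perm (Fin n), HasPCProofOfSize (C.rename fun x : Fin n × Fin n => σ • x) C t) ∧
      C.size + t + n + 2 ≤ 2 ^ ((Nat.log 2 n + a) ^ a) ∧
      ∃ X Y : SimpleGraph (Fin n), CkEquiv ((Nat.log 2 n + c') ^ c') X Y ∧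
        MvPolynomial.eval (Set.indicator {ij : Fin n × Fin n | X.Adj ij.1 ij.2} 1) C.eval ≠
          MvPolynomial.eval (Set.indicator {ij : Fin n × Fin n | Y.Adj ij.1 ij.2} 1) C.eval) :
    ¬ ∃ c : ℕ, ∀ (n t : ℕ) (C : PICircuit ℂ (Fin n × Fin n)),
      (∀ σ : Equiv.Perm (Fin n), HasPCProofOfSize (C.rename fun x : Fin n × Fin n => σ • x) C t) →
      ∃ C' : PICircuit ℂ (Fin n × Fin n), C'.eval = C.eval ∧
        C'.size ≤ (C.size + t + n + 2) ^ c ∧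
        ∀ σ : Equiv.Perm (Fin n),
          (pfSystem ℂ (Fin n × Fin n)).Provable (C'.rename fun x : Fin n × Fin n => σ • x).unfold
            C'.unfold ⊤ (fun s => if s = PIAxiom.A6 then 0 else ⊤) :=
  fun hS => stabilityOfProvableSymmetry_false_of_polylogProofCarrying h
    (stabilityOfProvableSymmetry_iff_proofsToDistEquiv.mpr hS)

end Summit.ValiantsHypothesis.ValiantsHypothesis.Theorems

end
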